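import Mathlib
import HarnessLib
import Summits.HubbardSuperconductivity.HubbardSuperconductivity.Theorems.KLProgrammeC4aAbsBubbleAngleLayer

/-!
# Route `KLProgramme` — crux C4a, S3 brick (B4)/(B5) «(B4)-DIRECT-PACK», part 8a: integrability of the logarithmic dominators `log⁺(M/‖ϑ − π‖_𝕋)`,
# `log⁺(M/‖ϑ‖_𝕋)` on `(0, 2π]` and on the chart box, and their angular integrals (carrier-free)

Cell `gate-hubbard-kl`, seat hubbard-kl-k3c3-p3 (g27; row «implicit-function / monotonicity route for μ(n)»).  Located brick for the (C)-closer lane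
hubbard-kl-c4a-1 (stub (C) `stub_twoLeg_curvature` of `KLRegimeEngineV17F2`, stmt-HubbardSuperconductivity-20437), memo B4-DIRECT-PACK.md §6; the shape is that of
`…C4aCoMovingJetsL1.CoMovingJetsL1` (dominators integrable on `(−r,r) ×ˢ (0,2π]` with a uniform angular integral, `setIntegral_box_norm_mul_le_of_unif`).
* `continuous_torusDist`, `posLog_le_abs_log`, `posLog_div_abs_le`; **`intervalIntegrable_posLog_div_abs`** (`log⁺(M/|ϑ − c|)` on any interval: one logarithmic
  singularity, dominated by `log⁺M + |log(ϑ − c)|`); **`integrableOn_posLog_div_torusDist_sub_pi`**, **`integrableOn_posLog_div_torusDist`** (on `(0,2π]`);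
  **`integrableOn_box_of_snd`** (a `ϑ`-only integrable dominator is integrable on the chart box);
* **`setIntegral_posLog_div_torusDist_sub_pi_le`** / **`setIntegral_posLog_div_torusDist_le`**: `∫_{(0,2π]} (K + P·log⁺(M/‖·‖_𝕋)) ≤ 2π(K + P(1 + log⁺(M/π)))`
  (`…C4aAbsBubbleLevelLoop.intervalIntegral_cooper_window_le`, periodicity for the ph window).
Pure real analysis; nothing about the Hubbard model.  References: Salmhofer 1999 §4.5.3 Cor. 4.11 [cite: Salmhofer1999].
-/

noncomputable section

namespace Summit.HubbardSuperconductivity.HubbardSuperconductivity.Theorems.C4a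

set_option linter.dupNamespace false -- summit = problem name (single-conjunct summit), D-0017

open Real Set MeasureTheory
open Literature.MathematicalPhysics.QuantumLattice.FermiRG
open Summit.HubbardSuperconductivity.HubbardSuperconductivity.Theorems.PerturbedFermiCurve

/-! ## §1 Integrability of the logarithmic dominators -/

/-- The torus distance is continuous. -/
theorem continuous_torusDist : Continuous (torusDist : ℝ → ℝ) := by
  unfold torusDist
  exact continuous_norm.comp (continuous_quotient_mk')

/-- `log⁺ y ≤ |log y|`. -/
theorem posLog_le_abs_log (y : ℝ) : log⁺ y ≤ |Real.log y| := by
  rw [Real.posLog_def]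
  exact max_le (abs_nonneg _) (le_abs_self _)

/-- `log⁺(M/|x − c|) ≤ log⁺ M + |log (x − c)|`. -/
theorem posLog_div_abs_le (M c x : ℝ) : log⁺ (M / |x - c|) ≤ log⁺ M + |Real.log (x - c)| := by
  rw [div_eq_mul_inv]
  refine (Real.posLog_mul).trans (add_le_add le_rfl ?_)
  refine (posLog_le_abs_log _).trans (le_of_eq ?_)
  rw [Real.log_inv, Real.log_abs, abs_neg]

/-- **`ϑ ↦ log⁺(M/|ϑ − c|)` is integrable on every interval** (one logarithmic singularity). -/
theorem intervalIntegrable_posLog_div_abs (M c a b : ℝ) : IntervalIntegrable (fun x : ℝ => log⁺ (M / |x - c|)) volume a b := by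
  have hlog : IntervalIntegrable (fun x : ℝ => Real.log (x - c)) volume a b := by
    have h := (intervalIntegral.intervalIntegrable_log' (a := a - c) (b := b - c)).comp_sub_right c
    simp only [sub_add_cancel] at h
    exact h
  have hdom : IntervalIntegrable (fun x : ℝ => log⁺ M + |Real.log (x - c)|) volume a b := intervalIntegrable_const.add hlog.abs
  refine hdom.mono_fun' ?_ ?_
  · refine (Real.continuous_posLog.measurable.comp ?_).aestronglyMeasurable
    exact measurable_const.div ((measurable_id.sub_const c).abs)
  · refine Filter.Eventually.of_forall fun x => ?_
    show ‖log⁺ (M / |x - c|)‖ ≤ log⁺ M + |Real.log (x - c)|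
    rw [Real.norm_eq_abs, abs_of_nonneg Real.posLog_nonneg]
    exact posLog_div_abs_le M c x

/-- **The pp dominator is integrable on `(0, 2π]`**: `ϑ ↦ log⁺(M/‖ϑ − π‖_𝕋)` (there `‖ϑ − π‖_𝕋 = |ϑ − π|`). -/
theorem integrableOn_posLog_div_torusDist_sub_pi (M : ℝ) : IntegrableOn (fun ϑ : ℝ => log⁺ (M / torusDist (ϑ - π))) (Ioc 0 (2 * π)) := by
  have h := (intervalIntegrable_posLog_div_abs M π 0 (2 * π)).1
  refine (h.congr_fun (fun ϑ hϑ => ?_) measurableSet_Ioc)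
  have habs : |ϑ - π| ≤ π := abs_le.2 ⟨by linarith [hϑ.1], by linarith [hϑ.2]⟩
  rw [torusDist_eq_abs_of_abs_le_pi habs]

/-- **The ph dominator is integrable on `(0, 2π]`**: `ϑ ↦ log⁺(M/‖ϑ‖_𝕋)` (dominated by the two endpoint logarithms). -/
theorem integrableOn_posLog_div_torusDist (M : ℝ) : IntegrableOn (fun ϑ : ℝ => log⁺ (M / torusDist ϑ)) (Ioc 0 (2 * π)) := by
  have h1 := (intervalIntegrable_posLog_div_abs M 0 0 (2 * π)).1
  have h2 := (intervalIntegrable_posLog_div_abs M (2 * π) 0 (2 * π)).1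
  have hdom : IntegrableOn (fun x : ℝ => log⁺ (M / |x - 0|) + log⁺ (M / |x - 2 * π|)) (Ioc 0 (2 * π)) := h1.add h2
  refine Integrable.mono' hdom ?_ ?_
  · refine (Real.continuous_posLog.measurable.comp ?_).aestronglyMeasurable
    exact measurable_const.div continuous_torusDist.measurable
  · refine (ae_restrict_iff' measurableSet_Ioc).2 (Filter.Eventually.of_forall fun ϑ hϑ => ?_)
    rw [Real.norm_eq_abs, abs_of_nonneg Real.posLog_nonneg]
    have hp1 : 0 ≤ log⁺ (M / |ϑ - 0|) := Real.posLog_nonneg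
    have hp2 : 0 ≤ log⁺ (M / |ϑ - 2 * π|) := Real.posLog_nonneg
    by_cases hle : ϑ ≤ π
    · have hT : torusDist ϑ = |ϑ - 0| := by
        rw [sub_zero]; exact torusDist_eq_abs_of_abs_le_pi (abs_le.2 ⟨by linarith [hϑ.1], hle⟩)
      rw [hT]; linarith
    · have hT : torusDist ϑ = |ϑ - 2 * π| := by
        have h := torusDist_add_int_mul_two_pi (ϑ - 2 * π) 1
        rw [show ϑ - 2 * π + ((1 : ℤ) : ℝ) * (2 * π) = ϑ by push_cast; ring] at h
        rw [h]
        exact torusDist_eq_abs_of_abs_le_pi (abs_le.2 ⟨by linarith [hϑ.2], by linarith [hϑ.2]⟩)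
      rw [hT]; linarith

/-- **A `ϑ`-only integrable dominator is integrable on the chart box** `(−r, r) ×ˢ (0, 2π]`. -/
theorem integrableOn_box_of_snd {g : ℝ → ℝ} (hg : IntegrableOn g (Ioc 0 (2 * π))) (r : ℝ) :
    IntegrableOn (fun p : ℝ × ℝ => g p.2) (Ioo (-r) r ×ˢ Ioc 0 (2 * π)) := by
  rw [IntegrableOn, Measure.volume_eq_prod, ← Measure.prod_restrict]
  have h1 : Integrable (fun _ : ℝ => (1 : ℝ)) ((volume : Measure ℝ).restrict (Ioo (-r) r)) := by
    have : IsFiniteMeasure ((volume : Measure ℝ).restrict (Ioo (-r) r)) := by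
      refine ⟨?_⟩
      rw [Measure.restrict_apply_univ]
      exact measure_Ioo_lt_top
    exact integrable_const _
  have h := h1.mul_prod hg
  simpa using h

/-! ## §2 The angular integrals of the dominators -/

/-- **`∫_{(0,2π]} (K + P·log⁺(M/‖ϑ − π‖_𝕋)) dϑ ≤ 2π·(K + P·(1 + log⁺(M/π)))`** (`K, P ≥ 0`). -/
theorem setIntegral_posLog_div_torusDist_sub_pi_le {K₀ P M : ℝ} (hK : 0 ≤ K₀) (hP : 0 ≤ P) :
    ∫ ϑ in Ioc 0 (2 * π), (K₀ + P * log⁺ (M / torusDist (ϑ - π))) ≤ 2 * π * (K₀ + P * (1 + log⁺ (M / π))) := by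
  have h := intervalIntegral_cooper_window_le (F := fun ϑ => K₀ + P * log⁺ (M / torusDist (ϑ - π))) (c := π) (δ := π) (M := M) Real.pi_pos hK hP
    (fun ϑ _ => by have : 0 ≤ log⁺ (M / torusDist (ϑ - π)) := Real.posLog_nonneg; positivity) fun ϑ hϑ _ => by
      have habs : |ϑ - π| ≤ π := abs_le.2 ⟨by linarith [hϑ.1], by linarith [hϑ.2]⟩
      rw [torusDist_eq_abs_of_abs_le_pi habs]
  rw [intervalIntegral.integral_of_le (by linarith [Real.pi_pos]), show π - π = 0 by ring, show π + π = 2 * π by ring] at h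
  exact h

/-- **`∫_{(0,2π]} (K + P·log⁺(M/‖ϑ‖_𝕋)) dϑ ≤ 2π·(K + P·(1 + log⁺(M/π)))`** (the ph dominator; periodicity moves the window to `(−π, π]`). -/
theorem setIntegral_posLog_div_torusDist_le {K₀ P M : ℝ} (hK : 0 ≤ K₀) (hP : 0 ≤ P) :
    ∫ ϑ in Ioc 0 (2 * π), (K₀ + P * log⁺ (M / torusDist ϑ)) ≤ 2 * π * (K₀ + P * (1 + log⁺ (M / π))) := by
  have hper : Function.Periodic (fun ϑ : ℝ => K₀ + P * log⁺ (M / torusDist ϑ)) (2 * π) := fun ϑ => by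
    have h := torusDist_add_int_mul_two_pi ϑ 1
    rw [show ϑ + ((1 : ℤ) : ℝ) * (2 * π) = ϑ + 2 * π by push_cast; ring] at h
    simp only [h]
  have h := intervalIntegral_cooper_window_le (F := fun ϑ => K₀ + P * log⁺ (M / torusDist ϑ)) (c := 0) (δ := π) (M := M) Real.pi_pos hK hP
    (fun ϑ _ => by have : 0 ≤ log⁺ (M / torusDist ϑ) := Real.posLog_nonneg; positivity) fun ϑ hϑ _ => by
      have habs : |ϑ| ≤ π := abs_le.2 ⟨by linarith [hϑ.1], by linarith [hϑ.2]⟩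
      rw [sub_zero, torusDist_eq_abs_of_abs_le_pi habs]
  rw [show (0 : ℝ) + π = 0 - π + 2 * π by ring, hper.intervalIntegral_add_eq (0 - π) 0, zero_add,
    intervalIntegral.integral_of_le (by linarith [Real.pi_pos])] at h
  exact h

end Summit.HubbardSuperconductivity.HubbardSuperconductivity.Theorems.C4a

end
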